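import Mathlib
import HarnessLib

/-!
# Strictly positive Riesz functionals have representing measures (Fialkow–Nie 2010, Thm. 1.3)

Topic `Literature/Analysis/Convex` (truncated moment problems; the proof in print is cone
duality: the closure of the cone of moment sequences with finitely atomic `K`-representing
measures is the dual of the `K`-positive Riesz functionals, and a strictly positive functional is
an interior point).

L. Fialkow, J. Nie, *Positivity of Riesz functionals and solutions of quadratic and quartic moment
problems*, J. Funct. Anal. 258 (2010) 328–356 (arXiv:0908.3230), §1 and Theorem 1.3
(= Theorem 2.4). Setting (§1, p. 2 of the arXiv version): `y = (y_α)_{|α| ≤ k}` is a real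
multisequence of degree `k` in `n` variables (a truncated moment sequence), `K ⊆ ℝⁿ` is CLOSED;
a `K`-representing measure is a positive Borel measure `μ` on `ℝⁿ`, supported in `K`, with
`y_α = ∫ x^α dμ` for all `|α| ≤ k`; the Riesz functional `L_y : 𝒫_k → ℝ`,
`L_y(Σ p_α x^α) = Σ p_α y_α`; `L_y` is `K`-positive if `L_y(p) ≥ 0` whenever `p ∈ 𝒫_k`,
`p|_K ≥ 0`, and strictly `K`-positive if moreover `L_y(p) > 0` whenever `p|_K ≥ 0`, `p|_K ≢ 0`;
`K` is a determining set of degree `k` if `p ∈ 𝒫_k`, `p|_K ≡ 0` imply `p ≡ 0` (sets with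
nonempty interior are determining).

**Theorem 1.3.** "Suppose `K` is a determining set of degree `k` and let `y` be a truncated moment
sequence of degree `k` in `n` variables. If `L_y` is strictly `K`-positive, then `y` admits a
`K`-representing measure." (By the Bayer–Teichmann theorem, quoted in §2, the measure may be
taken finitely atomic; not recorded in the statement below.)

Use in the tree: with `K = ℝⁿ` and odd `k = 2d + 1`, a polynomial of degree `≤ 2d + 1` that is
nonnegative on `ℝⁿ` has degree `≤ 2d`; for `d = 1` such polynomials are sums of squares of affine
forms (Hilbert, `n > 1`, `d = 1`, op. cit. p. 4), so `L_y` is strictly positive iff the moment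
matrix `M_1(y)` (mean and covariance) is positive definite — every degree-`3` moment datum with
positive definite covariance is realised by a probability measure ("odd-order realizability is
vacuous once the covariance is definite"), the parity half of
`Summit.AnomalousDissipation.AnomalousDissipation.Theses.MomentParity.CubicParityLoud`.

Design: the multisequence `y` is encoded by its Riesz functional, an `ℝ`-linear map
`L : MvPolynomial (Fin n) ℝ →ₗ[ℝ] ℝ` whose values on polynomials of total degree `> k` are
irrelevant (every hypothesis and conclusion is guarded by `p.totalDegree ≤ k`). A DEFINITION of
the statement (named fact, review-queued), no proof; users take `(h : FialkowNie2010_thm13)`.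
-/

namespace Literature.Analysis.Convex

open MeasureTheory

/-- **Fialkow–Nie 2010, Theorem 1.3** (strictly `K`-positive Riesz functionals of degree `k` have
`K`-representing measures). Let `K ⊆ ℝⁿ` be closed and determining of degree `k` (a polynomial
of total degree `≤ k` vanishing on `K` is zero), and let `L` be the Riesz functional of a
truncated moment sequence of degree `k` (an `ℝ`-linear functional on polynomials; only its values
in degree `≤ k` matter). If `L` is strictly `K`-positive — `L p ≥ 0` for every `p` of degree
`≤ k` with `p ≥ 0` on `K`, and `L p > 0` if moreover `p ≢ 0` on `K` — then there is a positive
Borel measure `μ` on `ℝⁿ` supported in `K` (`μ Kᶜ = 0`), with all moments of order `≤ k`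
finite, representing `L`: `L p = ∫ p dμ` for every `p` of degree `≤ k` (in particular `μ` is
finite, `p = 1`). Grounds the parity step of
`Summit.AnomalousDissipation.AnomalousDissipation.Theses.MomentParity.CubicParityLoud`
(`K = ℝⁿ`, `k = 3`: strict positivity ⟺ positive definite covariance).
[cite: FialkowNie2010, Thm. 1.3] -/
def FialkowNie2010_thm13 : Prop :=
  ∀ (n k : ℕ) (K : Set (Fin n → ℝ)), IsClosed K →
    (∀ p : MvPolynomial (Fin n) ℝ, p.totalDegree ≤ k →
      (∀ x ∈ K, MvPolynomial.eval x p = 0) → p = 0) →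
    ∀ L : MvPolynomial (Fin n) ℝ →ₗ[ℝ] ℝ,
      (∀ p : MvPolynomial (Fin n) ℝ, p.totalDegree ≤ k →
        (∀ x ∈ K, 0 ≤ MvPolynomial.eval x p) → 0 ≤ L p) →
      (∀ p : MvPolynomial (Fin n) ℝ, p.totalDegree ≤ k →
        (∀ x ∈ K, 0 ≤ MvPolynomial.eval x p) → (∃ x ∈ K, MvPolynomial.eval x p ≠ 0) → 0 < L p) →
      ∃ μ : Measure (Fin n → ℝ), IsFiniteMeasure μ ∧ μ Kᶜ = 0 ∧
        ∀ p : MvPolynomial (Fin n) ℝ, p.totalDegree ≤ k →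
          Integrable (fun x => MvPolynomial.eval x p) μ ∧
            L p = ∫ x, MvPolynomial.eval x p ∂μ

end Literature.Analysis.Convex
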